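import Summits.ResolutionOfSingularities.ResolutionOfSingularities.Theorems.MarkedTransferCampaignW46FiniteExitBound
import Summits.ResolutionOfSingularities.ResolutionOfSingularities.Theorems.MarkedTransferCampaignW46CuspStaircasePermissibleStep
import Summits.ResolutionOfSingularities.ResolutionOfSingularities.Theorems.MarkedTransferCampaignW46MohWindowCurveInstance
import Literature.AlgebraicGeometry.Resolution.PointCentrePermissible
import Literature.AlgebraicGeometry.Resolution.BlowupDimension
import Literature.AlgebraicGeometry.Resolution.BlowupsExistence
import Literature.AlgebraicGeometry.Resolution.BlowupsIntegral
import Literature.AlgebraicGeometry.Resolution.BlowupsProperProofs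
import Literature.AlgebraicGeometry.Resolution.RegularBlowup
import Literature.AlgebraicGeometry.Resolution.RegularCentreBlowupSeqIntegral
import Literature.AlgebraicGeometry.Resolution.SmoothOfRegularPerfectField
import HarnessLib

/-!
# [OURS · L1 W4.6 rung (i-a)′] KERNEL WITNESS OF A NON-TRIVIAL FINITE PERMISSIBLE SEQUENCE in `regimePlaneIsolated`:
# a length-1 `FinPermissibleRun` (the blow-up of the origin of `𝔸²_K` under the cusp `((y^p + x^{p+1})·𝒪, p)`) whose
# centre meets the fibre over the origin — so `FinLocalExitBound regimePlaneIsolated` is visibly NOT a statement about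
# length-0 sequences only (cell res-hironaka, LADDER-RESOLUTION rung L, D-0089; campaign s46; object (1) of res-L1-type-o1's
# NAMING 2026-08-27T05:33:25Z, taken by the reserve prover res-type-008; host route MarkedTransfer,
# `--kind proof --supports stmt-ResolutionOfSingularities-16156 --as helper`; companion of `…W46FiniteExitBound.lean`
# (res-L1-type-o1, p488284), `…W46MohWindowCurveInstance.lean` (res-L1-s46-pv-13, p498082) and
# `…W46CuspStaircasePermissibleStep.lean` (res-L1-s46-pv-5))

HONEST FRAMING. Nothing here is a statement of H. Hironaka's manuscript (2017-03-23, [Hironaka2017]) and nothing here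
asserts that any statement of it holds. Everything is OURS: kernel theorems about the campaign's typed finite permissible
sequences (`CampaignW46.FinPermissibleRun`, `CampaignW46.regimePlaneIsolated`, `CampaignW46.FinLocalExitBound`) at ONE
explicit state, assembled from TREE THEOREMS (the blow-up library `Literature/AlgebraicGeometry/Resolution/*`:
`exists_isBlowup`, `IsBlowup.isIntegral` / `.isProper` / `.isRegular_of_isRegular_subscheme` / `.topologicalKrullDim_le` /
`.comap_ne_bot`, `smooth_of_isRegular_of_perfectField`, `isRegular_subscheme_vanishingIdeal_singleton`) and the campaign
companions (res-L1-s46-pv-13's scheme-level cusp state `CuspPlane.regime_cuspCurve` / `sing_eq` / `isStandard`;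
res-L1-s46-pv-5's résumé-free one-step law `Cusp.transform_cuspCurve`). The manuscript enters only through the typed
CANDIDATE carriers of row 001 (`AmbientDatum`, `IdealExponent`, `IsPermissibleCentre`, `transform`). No FACT-LIST premise
is used. AI review is weaker than expert review. No `sorry`; axioms standard.

## What this file does (res-L1-type-o1 NAMING (1), verbatim task: «exhibit `r : CampaignW46.FinPermissibleRun p K` with
## `r.len = 1` all of whose stages lie in `regimePlaneIsolated` … and a finset `s = {0}` meeting the fibre — so
## `FinLocalExitBound regimePlaneIsolated` is visibly not a statement about length-0 runs only»)

Base field: `K` PERFECT of characteristic `p` (every prime `p`) — the tree's route to make a blown-up ambient scheme an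
ambient datum again (regular ⇒ smooth over a perfect field), as in `CampaignW46.exists_procrastinatingStep`.

* Stage 0 (`§1`): `A₀ = U82Gap.amb p K` (the affine plane `Spec K[x,y] → Spec K` of `Proofs/S16Proof/U82p3fModel.lean`),
  `E₀ = ((y^p + x^{p+1})·𝒪, p)` — res-L1-s46-pv-13's state VERBATIM; `Sing(E₀) = {ξ}` (the origin), `E₀` standard, and
  `regimePlaneIsolated A₀ E₀` (`dim 𝔸² ≤ 2` + `CuspPlane.regime_cuspCurve`).
* The centre (`§2`): `D₀ = {ξ}` is §2.1-permissible for `E₀` (`IsPermissibleCentre`: irreducible, the reduced point is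
  regular hence smooth over the perfect `K`, `{ξ} ⊆ Sing(E₀)`), and `V(𝓘_{D₀}) ≠ Z` (the generic point is not the origin).
* The step (`§3`, `exists_blowupStep`): an ACTUAL blow-up `π₀ : Z₁ → 𝔸²` along `𝓘_{D₀}` (`exists_isBlowup`) with `Z₁` an
  ambient datum `A₁ = ⟨Z₁, π₀ ≫ hom⟩` (integral, regular by Liu 8.1.19 (a), smooth over the perfect field, proper hence
  quasi-compact), the transform `E₁ = E₀.transform π₀ D₀` STANDARD (`J𝒪 ⊆ J′`, `J𝒪 ≠ 0`), and stage 1 AGAIN in the regime: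
  `dim Z₁ ≤ 2` (`IsBlowup.topologicalKrullDim_le`) and `Sing(E₁)` a finite set of closed points (pv-5's
  `Cusp.transform_cuspCurve`: the cusp staircase regime is stable under the permissible point blow-up).
* The run (`§4`): `exists_finPermissibleRun_len_one` — a `FinPermissibleRun p K` with `len = 1`, stages `0, 1` in
  `regimePlaneIsolated`, stage 0 the cusp state, and the finset `s = {0}` of stage indices `< len` whose centre `D₀` meets
  the fibre of `Z₀ → Z₀` over `ξ` (padding beyond `len` by identities, DESIGN POINT (PAD) of the companion).
* The consequence (`§4`): `one_le_of_finLocalExitBound_clause` — EVERY `β` satisfying the clause of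
  `FinLocalExitBound regimePlaneIsolated` has `1 ≤ β(𝔸²_K, E₀, ξ)`; in particular no such `β` vanishes identically
  (`not_finLocalExitBound_clause_of_zero_at_cusp`): the exit-bound form of rung (i-a) constrains `β` at honest singular states.

Disjoint from res-D-pv-044 and res-D-pv-046 AS s46-pv-8 and s46-pv-9 (who PROVE the bound); nothing of theirs or of
pv-5 / pv-13 / res-L1-type-o1 is edited or restated.

## References

* companions `…W46FiniteExitBound` (res-L1-type-o1), `…W46PlaneIsolated` / `…W46LiteralCentreProcrastination` (pv-1),
  `…W46CuspStaircasePermissibleStep` (pv-5), `…W46MohWindowCurveInstance` (pv-13); HOME/STATUS NAMING 2026-08-27T05:33:25Z.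
* Q. Liu, *Algebraic Geometry and Arithmetic Curves* (2002), Thm. 8.1.19 (a) — via the tree theorem
  `IsBlowup.isRegular_of_isRegular_subscheme`. [Liu2002] U. Görtz, T. Wedhorn, *Algebraic Geometry I* (2020),
  Prop. 13.92 / 13.96 — via `exists_isBlowup` / `IsBlowup.isProper`. [GortzWedhorn2020]
* H. Hironaka, ms. 2017-03-23, §2.1 p.4 l.34–39, Def. 2.1 p.5 l.2–3, Th. 16.13 p.87 l.26–28 — scope only, under
  adjudication, not cited as fact. [Hironaka2017]
-/

noncomputable section

set_option linter.dupNamespace false -- mandated namespace of this single-conjunct summit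

open CategoryTheory AlgebraicGeometry TopologicalSpace MvPolynomial

namespace Summit.ResolutionOfSingularities.ResolutionOfSingularities.Theorems

namespace CampaignW46

namespace FinExitWitness

open Literature.AlgebraicGeometry.Resolution
open Literature.AlgebraicGeometry.Hironaka2017.S02Preliminaries
open Literature.AlgebraicGeometry.Hironaka2017.SpecOrders
open Literature.AlgebraicGeometry.Hironaka2017.S16Proof
open Scheme.IdealSheafData

universe u

variable (p : ℕ) [Fact p.Prime] (K : Type u) [Field K] [CharP K p]

/-! ## §1 Stage 0: the cusp `((y^p + x^{p+1})·𝒪, p)` on the affine plane -/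

/-- `p ∤ p + 1`. [folklore] -/
theorem not_dvd_succ : ¬ p ∣ p + 1 :=
  have hp2 : 2 ≤ p := (Fact.out : p.Prime).two_le
  CuspPlane.not_dvd_of_window p (Nat.lt_succ_self p) (by omega)

/-- `dim 𝔸²_K ≤ 2` for the plane of `U82p3fModel`. [folklore] -/
theorem topologicalKrullDim_plane_le_two :
    topologicalKrullDim (U82Gap.amb p K).Z ≤ ((2 : ℕ) : WithBot ℕ∞) := by
  show topologicalKrullDim (PrimeSpectrum (MvPolynomial (Fin 2) K)) ≤ _
  rw [PrimeSpectrum.topologicalKrullDim_eq_ringKrullDim,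
    MvPolynomial.ringKrullDim_of_isNoetherianRing, ringKrullDim_eq_zero_of_field, zero_add]
  simp

/-- The singular locus of stage 0 is the origin: `Sing(E₀) = {ξ}`. [folklore] -/
theorem sing_stage0 :
    (⟨shf (MvPolynomial (Fin 2) K) (Ideal.span {X 1 ^ p + X 0 ^ (p + 1)}), p⟩ :
        IdealExponent (U82Gap.amb p K).Z).sing = {U82Gap.ξ K} :=
  CuspPlane.sing_eq p K (Nat.le_succ p) (not_dvd_succ p)

/-- Stage 0 is standard (`J ≠ 0`, `b = p > 0`). [folklore] -/
theorem isStandard_stage0 :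
    (⟨shf (MvPolynomial (Fin 2) K) (Ideal.span {X 1 ^ p + X 0 ^ (p + 1)}), p⟩ :
        IdealExponent (U82Gap.amb p K).Z).IsStandard :=
  CuspPlane.isStandard p K (by omega)

/-- Stage 0 lies in res-L1-s46-pv-5's cusp staircase regime. [folklore] -/
theorem cuspCurve_stage0 :
    Regime.cuspCurve (p := p) (K := K) (U82Gap.amb p K)
      ⟨shf (MvPolynomial (Fin 2) K) (Ideal.span {X 1 ^ p + X 0 ^ (p + 1)}), p⟩ :=
  CuspPlane.regime_cuspCurve p K (Nat.lt_succ_self p) (not_dvd_succ p)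

/-- **Stage 0 lies in `regimePlaneIsolated`** (a surface; `Sing(E₀) = {ξ}` finite, closed points). [folklore] -/
theorem regimePlaneIsolated_stage0 :
    regimePlaneIsolated (p := p) (K := K) (U82Gap.amb p K)
      ⟨shf (MvPolynomial (Fin 2) K) (Ideal.span {X 1 ^ p + X 0 ^ (p + 1)}), p⟩ := by
  have hRg := cuspCurve_stage0 p K
  exact (regimePlaneIsolated_iff _ _).mpr ⟨topologicalKrullDim_plane_le_two p K, hRg.2.1, hRg.2.2.1⟩

/-! ## §2 The centre: the origin, a §2.1-permissible centre for `E₀` -/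

/-- The generic point of the plane is not the origin, so `{ξ} ≠ 𝔸²`. [folklore] -/
theorem singleton_ξ_ne_univ : ({U82Gap.ξ K} : Set (U82Gap.amb p K).Z) ≠ Set.univ := by
  intro h
  let η : (U82Gap.amb p K).Z := ⟨(⊥ : Ideal (MvPolynomial (Fin 2) K)), Ideal.isPrime_bot⟩
  have hη : η ∈ ({U82Gap.ξ K} : Set (U82Gap.amb p K).Z) := h ▸ Set.mem_univ η
  have hηξ : η = U82Gap.ξ K := hη
  have hX : (X 0 : MvPolynomial (Fin 2) K) ∈ (U82Gap.ξ K).asIdeal := by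
    show (X 0 : MvPolynomial (Fin 2) K) ∈ originIdeal K 2
    rw [mem_originIdeal_iff]
    exact constantCoeff_X K 0
  rw [← hηξ] at hX
  exact X_ne_zero (0 : Fin 2) ((Ideal.mem_bot).mp hX)

/-- `V(𝓘_{{ξ}})` is not all of `𝔸²` (as a support). [folklore] -/
theorem support_vanishingIdeal_origin_ne_top :
    (vanishingIdeal (⟨{U82Gap.ξ K}, U82Gap.ξ_isClosed K⟩ : Closeds (U82Gap.amb p K).Z)).support ≠ ⊤ := by
  intro h
  apply singleton_ξ_ne_univ p K
  have := congrArg (fun S : Closeds (U82Gap.amb p K).Z => (S : Set (U82Gap.amb p K).Z)) h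
  simpa [Scheme.IdealSheafData.coe_support_vanishingIdeal] using this

/-- `𝓘_{{ξ}} ≠ 0`. [folklore] -/
theorem vanishingIdeal_origin_ne_bot :
    vanishingIdeal (⟨{U82Gap.ξ K}, U82Gap.ξ_isClosed K⟩ : Closeds (U82Gap.amb p K).Z) ≠ ⊥ := fun h =>
  support_vanishingIdeal_origin_ne_top p K (by rw [h, Scheme.IdealSheafData.support_bot])

/-- The reduced origin `V(𝓘_{{ξ}})` is a regular scheme (a closed point: its local ring is the residue field).
[folklore] -/
theorem isRegular_subscheme_origin :
    Scheme.IsRegular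
      (vanishingIdeal (⟨{U82Gap.ξ K}, U82Gap.ξ_isClosed K⟩ : Closeds (U82Gap.amb p K).Z)).subscheme := by
  haveI : IsLocallyNoetherian (U82Gap.amb p K).Z := ambient_isLocallyNoetherian _
  exact isRegular_subscheme_vanishingIdeal_singleton (U82Gap.ξ_isClosed K)

/-- **The origin is a §2.1-permissible centre for `E₀`** over a perfect field (irreducible; the reduced point is regular,
hence smooth over `K`; `{ξ} ⊆ Sing(E₀)`). [folklore] -/
theorem isPermissibleCentre_origin [PerfectField K] :
    (⟨shf (MvPolynomial (Fin 2) K) (Ideal.span {X 1 ^ p + X 0 ^ (p + 1)}), p⟩ :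
        IdealExponent (U82Gap.amb p K).Z).IsPermissibleCentre (U82Gap.amb p K).hom
      ⟨{U82Gap.ξ K}, U82Gap.ξ_isClosed K⟩ := by
  haveI := (U82Gap.amb p K).smooth
  exact
    { irreducible := isIrreducible_singleton
      smooth := smooth_of_isRegular_of_perfectField _ (isRegular_subscheme_origin p K)
      subset_sing := by
        rw [sing_stage0 p K]
        exact subset_of_eq rfl }

/-! ## §3 The step: an actual blow-up of the origin, its ambient datum, and stage 1 in the regime -/

/-- **The permissible step exists and stays in the regime** (perfect base field, every prime `p`): there are an ambient
datum `A₁` and a morphism `π₀ : A₁.Z ⟶ 𝔸²_K` over `K` which IS the blowing up of `𝔸²_K` along the reduced ideal of the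
origin, such that the transform `E₁ = E₀.transform π₀ {ξ}` (Def. 2.1) is standard and `(A₁, E₁)` lies in
`regimePlaneIsolated` (and in the cusp staircase regime). The blow-up exists by the tree (`exists_isBlowup`, GW 13.92); it
is integral (non-zero centre ideal), regular (Liu 8.1.19 (a), `IsBlowup.isRegular_of_isRegular_subscheme`), hence smooth
over the perfect field, and proper (GW 13.96) hence quasi-compact over `K`; `dim ≤ 2` is inherited
(`IsBlowup.topologicalKrullDim_le`); `Sing(E₁)` is a finite set of closed points by res-L1-s46-pv-5's
`Cusp.transform_cuspCurve`. [cite: Liu2002, Thm. 8.1.19 (a)] -/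
theorem exists_blowupStep [PerfectField K] :
    ∃ (A₁ : AmbientDatum p K) (π₀ : A₁.Z ⟶ (U82Gap.amb p K).Z),
      A₁.hom = π₀ ≫ (U82Gap.amb p K).hom ∧
      IsBlowup π₀ (vanishingIdeal (⟨{U82Gap.ξ K}, U82Gap.ξ_isClosed K⟩ : Closeds (U82Gap.amb p K).Z)) ∧
      ((⟨shf (MvPolynomial (Fin 2) K) (Ideal.span {X 1 ^ p + X 0 ^ (p + 1)}), p⟩ :
          IdealExponent (U82Gap.amb p K).Z).transform π₀ ⟨{U82Gap.ξ K}, U82Gap.ξ_isClosed K⟩).IsStandard ∧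
      regimePlaneIsolated A₁
        ((⟨shf (MvPolynomial (Fin 2) K) (Ideal.span {X 1 ^ p + X 0 ^ (p + 1)}), p⟩ :
          IdealExponent (U82Gap.amb p K).Z).transform π₀ ⟨{U82Gap.ξ K}, U82Gap.ξ_isClosed K⟩) ∧
      Regime.cuspCurve A₁
        ((⟨shf (MvPolynomial (Fin 2) K) (Ideal.span {X 1 ^ p + X 0 ^ (p + 1)}), p⟩ :
          IdealExponent (U82Gap.amb p K).Z).transform π₀ ⟨{U82Gap.ξ K}, U82Gap.ξ_isClosed K⟩) := by
  -- abbreviations (local, proof-internal)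
  set A₀ : AmbientDatum p K := U82Gap.amb p K with hA₀
  set E₀ : IdealExponent A₀.Z :=
    ⟨shf (MvPolynomial (Fin 2) K) (Ideal.span {X 1 ^ p + X 0 ^ (p + 1)}), p⟩ with hE₀
  set D₀ : Closeds A₀.Z := ⟨{U82Gap.ξ K}, U82Gap.ξ_isClosed K⟩ with hD₀
  haveI := A₀.smooth
  haveI := A₀.quasiCompact
  haveI : IsLocallyNoetherian A₀.Z := ambient_isLocallyNoetherian A₀
  haveI : IsIntegral A₀.Z := ambient_isIntegral A₀
  have hZreg : Scheme.IsRegular A₀.Z := ambient_isRegular A₀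
  have hreg : Scheme.IsRegular (vanishingIdeal D₀).subscheme := isRegular_subscheme_origin p K
  -- the blow-up of the plane at the origin
  obtain ⟨Z₁, π₀, hπ⟩ := exists_isBlowup A₀.Z (vanishingIdeal D₀)
  have hDtop : (vanishingIdeal D₀).support ≠ ⊤ := support_vanishingIdeal_origin_ne_top p K
  have hDne : vanishingIdeal D₀ ≠ ⊥ := vanishingIdeal_origin_ne_bot p K
  haveI : IsIntegral Z₁ := hπ.isIntegral hDne
  haveI : IsProper π₀ := hπ.isProper
  have hZ₁reg : Scheme.IsRegular Z₁ := hπ.isRegular_of_isRegular_subscheme hZreg hreg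
  haveI : Smooth (π₀ ≫ A₀.hom) := smooth_of_isRegular_of_perfectField _ hZ₁reg
  let A₁ : AmbientDatum p K :=
    { Z := Z₁, hom := π₀ ≫ A₀.hom, irreducible := inferInstance, smooth := inferInstance,
      quasiCompact := inferInstance }
  have hRg₀ : Regime.cuspCurve A₀ E₀ := cuspCurve_stage0 p K
  have hE₀ : E₀.IsStandard := isStandard_stage0 p K
  have hDS : (D₀ : Set A₀.Z) ⊆ E₀.sing := (isPermissibleCentre_origin p K).subset_sing
  have hDirr : IsIrreducible (D₀ : Set A₀.Z) := isIrreducible_singleton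
  -- stage 1 in the cusp staircase regime (pv-5's résumé-free one-step law)
  have hRg₁ : Regime.cuspCurve A₁ (E₀.transform π₀ D₀) :=
    Cusp.transform_cuspCurve (A' := A₁) hπ rfl hRg₀ hDirr hDS
  refine ⟨A₁, π₀, rfl, hπ, ⟨?_, hE₀.2⟩, ?_, hRg₁⟩
  · -- `J′ ⊇ J𝒪_{Z₁} ≠ 0`
    intro hbot
    apply hπ.comap_ne_bot hDtop hE₀.1
    have hle : E₀.J.comap π₀ ≤ (E₀.transform π₀ D₀).J :=
      comap_le_controlledTransform π₀ (vanishingIdeal D₀) E₀.J E₀.b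
    rw [hbot] at hle
    exact le_bot_iff.1 hle
  · -- `regimePlaneIsolated` at stage 1
    exact (regimePlaneIsolated_iff A₁ _).mpr
      ⟨hπ.topologicalKrullDim_le (topologicalKrullDim_plane_le_two p K), hRg₁.2.1, hRg₁.2.2.1⟩

/-! ## §4 The finite run of length 1 and the consequence for `FinLocalExitBound regimePlaneIsolated` -/

/-- **[OURS · W4.6 rung (i-a)′] A NON-TRIVIAL FINITE PERMISSIBLE SEQUENCE IN THE REGIME OF RUNG (i-a)** (perfect `K`,
every prime `p`): there is a finite §2.1-permissible sequence `r` (`CampaignW46.FinPermissibleRun`) of length `1` all of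
whose stages `0, 1` lie in `regimePlaneIsolated`, starting at the cusp state `(𝔸²_K, ((y^p + x^{p+1})·𝒪, p))`, whose one
centre `D₀ = {ξ}` is blown up by an actual blow-up and meets the fibre of `Z₀ → Z₀` over the origin `ξ`: the finset
`s = {0}` of stage indices satisfies the hypothesis of the clause of `FinLocalExitBound` at `x = ξ`; the start is pinned
as an equality of states (res-L1-s46-pv-5's Σ-convention of `CuspPlane.finPermissibleRun_len_le`, whose bound
`len ≤ (p+1)/p = 1` this run attains). NOT a statement of the manuscript. [folklore] -/
theorem exists_finPermissibleRun_len_one [PerfectField K] :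
    ∃ r : FinPermissibleRun p K,
      (⟨r.A 0, r.E 0⟩ : Σ A : AmbientDatum p K, IdealExponent A.Z) =
          ⟨U82Gap.amb p K, ⟨shf (MvPolynomial (Fin 2) K) (Ideal.span {X 1 ^ p + X 0 ^ (p + 1)}), p⟩⟩ ∧
      r.len = 1 ∧ (∀ k, k ≤ r.len → regimePlaneIsolated (r.A k) (r.E k)) ∧
        ∃ x : (r.A 0).Z, x ∈ (r.E 0).sing ∧
          ∀ m ∈ ({0} : Finset ℕ), m < r.len ∧ ∃ y ∈ (r.D m : Set (r.A m).Z), r.down m y = x := by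
  obtain ⟨A₁, π₀, hhom, hπ, hstd₁, hRg₁, -⟩ := exists_blowupStep p K
  refine
    ⟨{ len := 1
       A := fun k => match k with
         | 0 => U82Gap.amb p K
         | _ + 1 => A₁
       E := fun k => match k with
         | 0 => ⟨shf (MvPolynomial (Fin 2) K) (Ideal.span {X 1 ^ p + X 0 ^ (p + 1)}), p⟩
         | _ + 1 =>
           (⟨shf (MvPolynomial (Fin 2) K) (Ideal.span {X 1 ^ p + X 0 ^ (p + 1)}), p⟩ :
               IdealExponent (U82Gap.amb p K).Z).transform π₀ ⟨{U82Gap.ξ K}, U82Gap.ξ_isClosed K⟩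
       D := fun k => match k with
         | 0 => ⟨{U82Gap.ξ K}, U82Gap.ξ_isClosed K⟩
         | _ + 1 => ⊥
       π := fun k => match k with
         | 0 => π₀
         | _ + 1 => 𝟙 A₁.Z
       standard := fun k hk => by
         interval_cases k
         · exact isStandard_stage0 p K
         · exact hstd₁
       permissible := fun k hk => by
         obtain rfl : k = 0 := by omega
         exact isPermissibleCentre_origin p K
       hom_eq := fun k hk => by
         obtain rfl : k = 0 := by omega
         exact hhom
       blowup := fun k hk => by
         obtain rfl : k = 0 := by omega
         exact hπ
       E_succ := fun k hk => by
         obtain rfl : k = 0 := by omega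
         rfl },
      rfl, rfl, ?_, U82Gap.ξ K, ?_, ?_⟩
  · intro k hk
    interval_cases k
    · exact regimePlaneIsolated_stage0 p K
    · exact hRg₁
  · change U82Gap.ξ K ∈
        (⟨shf (MvPolynomial (Fin 2) K) (Ideal.span {X 1 ^ p + X 0 ^ (p + 1)}), p⟩ :
          IdealExponent (U82Gap.amb p K).Z).sing
    rw [sing_stage0 p K]
    rfl
  · intro m hm
    obtain rfl : m = 0 := by simpa using hm
    exact ⟨Nat.zero_lt_one, U82Gap.ξ K, rfl, rfl⟩

/-- **[OURS · W4.6 rung (i-a)′] THE EXIT-BOUND CLAUSE IS NOT ABOUT LENGTH-0 RUNS ONLY** (perfect `K`, every prime `p`): every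
function `β(A, E, x)` satisfying the clause of `CampaignW46.FinLocalExitBound regimePlaneIsolated` — `#s ≤ β(A₀, E₀, x)` for
every finite permissible sequence inside the regime, every point `x` of stage 0 and every finset `s` of stage indices
`< len` whose centres meet the fibre over `x` — satisfies `1 ≤ β(𝔸²_K, ((y^p + x^{p+1})·𝒪, p), ξ)` at the cusp state and
its singular point (apply the clause to the length-1 sequence of `exists_blowupStep` and `s = {0}`). NOT a statement of the
manuscript. [folklore] -/
theorem one_le_of_finLocalExitBound_clause [PerfectField K]
    (β : ∀ A : AmbientDatum p K, IdealExponent A.Z → A.Z → ℕ)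
    (hβ : ∀ r : FinPermissibleRun p K, (∀ k, k ≤ r.len → regimePlaneIsolated (r.A k) (r.E k)) →
      ∀ (x : (r.A 0).Z) (s : Finset ℕ),
        (∀ m ∈ s, m < r.len ∧ ∃ y ∈ (r.D m : Set (r.A m).Z), r.down m y = x) → s.card ≤ β (r.A 0) (r.E 0) x) :
    1 ≤ β (U82Gap.amb p K) ⟨shf (MvPolynomial (Fin 2) K) (Ideal.span {X 1 ^ p + X 0 ^ (p + 1)}), p⟩ (U82Gap.ξ K) := by
  obtain ⟨A₁, π₀, hhom, hπ, hstd₁, hRg₁, -⟩ := exists_blowupStep p K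
  let r : FinPermissibleRun p K :=
    { len := 1
      A := fun k => match k with
        | 0 => U82Gap.amb p K
        | _ + 1 => A₁
      E := fun k => match k with
        | 0 => ⟨shf (MvPolynomial (Fin 2) K) (Ideal.span {X 1 ^ p + X 0 ^ (p + 1)}), p⟩
        | _ + 1 =>
          (⟨shf (MvPolynomial (Fin 2) K) (Ideal.span {X 1 ^ p + X 0 ^ (p + 1)}), p⟩ :
              IdealExponent (U82Gap.amb p K).Z).transform π₀ ⟨{U82Gap.ξ K}, U82Gap.ξ_isClosed K⟩
      D := fun k => match k with
        | 0 => ⟨{U82Gap.ξ K}, U82Gap.ξ_isClosed K⟩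
        | _ + 1 => ⊥
      π := fun k => match k with
        | 0 => π₀
        | _ + 1 => 𝟙 A₁.Z
      standard := fun k hk => by
        interval_cases k
        · exact isStandard_stage0 p K
        · exact hstd₁
      permissible := fun k hk => by
        obtain rfl : k = 0 := by omega
        exact isPermissibleCentre_origin p K
      hom_eq := fun k hk => by
        obtain rfl : k = 0 := by omega
        exact hhom
      blowup := fun k hk => by
        obtain rfl : k = 0 := by omega
        exact hπ
      E_succ := fun k hk => by
        obtain rfl : k = 0 := by omega
        rfl }
  have hreg : ∀ k, k ≤ r.len → regimePlaneIsolated (r.A k) (r.E k) := by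
    intro k hk
    change k ≤ 1 at hk
    interval_cases k
    · exact regimePlaneIsolated_stage0 p K
    · exact hRg₁
  have key := hβ r hreg (U82Gap.ξ K) {0} fun m hm => by
    obtain rfl : m = 0 := by simpa using hm
    exact ⟨Nat.zero_lt_one, U82Gap.ξ K, rfl, rfl⟩
  simpa using key

/-- **[OURS · W4.6 rung (i-a)′] Corollary: no `β` vanishing at the cusp state satisfies the clause** — in particular
`β ≡ 0` does not witness `FinLocalExitBound regimePlaneIsolated` (contrast: over INFINITE runs, `β ≡ 0` witnesses
`LocalExitBound Rg` as soon as `PermissiblyTerminates Rg`, companion `…W46PlaneIsolated.lean`). NOT a statement of the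
manuscript. [folklore] -/
theorem not_finLocalExitBound_clause_of_zero_at_cusp [PerfectField K]
    (β : ∀ A : AmbientDatum p K, IdealExponent A.Z → A.Z → ℕ)
    (h0 : β (U82Gap.amb p K) ⟨shf (MvPolynomial (Fin 2) K) (Ideal.span {X 1 ^ p + X 0 ^ (p + 1)}), p⟩ (U82Gap.ξ K) = 0) :
    ¬ ∀ r : FinPermissibleRun p K, (∀ k, k ≤ r.len → regimePlaneIsolated (r.A k) (r.E k)) →
      ∀ (x : (r.A 0).Z) (s : Finset ℕ),
        (∀ m ∈ s, m < r.len ∧ ∃ y ∈ (r.D m : Set (r.A m).Z), r.down m y = x) → s.card ≤ β (r.A 0) (r.E 0) x := by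
  intro hβ
  have h1 := one_le_of_finLocalExitBound_clause p K β hβ
  omega

/-- **[OURS · W4.6 rung (i-a)′] The same, phrased on the decl of record**: if `PlaneIsolatedFinLocalExitBound p K` holds,
its witness `β` is `≥ 1` at the cusp state — the decl quantifies over genuinely non-trivial finite sequences. NOT a statement
of the manuscript. [folklore] -/
theorem exists_one_le_of_planeIsolatedFinLocalExitBound [PerfectField K] (h : PlaneIsolatedFinLocalExitBound p K) :
    ∃ β : ∀ A : AmbientDatum p K, IdealExponent A.Z → A.Z → ℕ,
      (∀ r : FinPermissibleRun p K, (∀ k, k ≤ r.len → regimePlaneIsolated (r.A k) (r.E k)) →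
        ∀ (x : (r.A 0).Z) (s : Finset ℕ),
          (∀ m ∈ s, m < r.len ∧ ∃ y ∈ (r.D m : Set (r.A m).Z), r.down m y = x) → s.card ≤ β (r.A 0) (r.E 0) x) ∧
      1 ≤ β (U82Gap.amb p K) ⟨shf (MvPolynomial (Fin 2) K) (Ideal.span {X 1 ^ p + X 0 ^ (p + 1)}), p⟩ (U82Gap.ξ K) := by
  obtain ⟨β, hβ⟩ := h
  exact ⟨β, hβ, one_le_of_finLocalExitBound_clause p K β hβ⟩

end FinExitWitness

end CampaignW46

end Summit.ResolutionOfSingularities.ResolutionOfSingularities.Theorems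

end
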